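import Summits.PneNP.PneNP.Theorems.ChebyshevTracialDesignVirtualLayerRatio
import HarnessLib

/-!
# Cell pnp-psdrank, route `ChebyshevTracialDesign`: the SHARP layer ratio — `ρ_{2κ} = R_κ − 1 ≤ 2κ·(1/(t+1−2κ) + 1/(n−t+1−2κ) + …) ≤ 24κ/n`:
# the virtual level re-weights the tight-level modes by `1 + O(κ/n)`, not by `2^κ` (crux `TracialDecayExp20`, stmt-PneNP-19878)

Brick 174 (prover g34; MEMO-37 §3). Brick 44b (`…VirtualLayerRatio`) proved that Grigoriev's per-matching virtual functional is, on every
harmonic layer `2κ`, the normalised TIGHT functional times the layer ratio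
`R_κ = Π_{i<κ} (2a+1−2i)(n−2a−1−2i)/((2a−2i)(n−2a−2−2i))` (`t = 2a+1`), and recorded `1 ≤ R_κ ≤ 2^κ` (`one_le_layerRatio`,
`layerRatio_le_two_pow`); brick 45 (`…VirtualBimode.virtual_rectangle_ge`) consumed the crude `2^κ`, which is why VNS (brick 46) needs the head modes
to decay like `16^{−κ}` and only extracts `Virt ≥ (3/7)μν`. The ratio is in fact `1 + O(κ/n)`:
* §1 `one_add_mul_pow_le` — `(1+x)^κ ≤ 1 + 2κx` for `0 ≤ x`, `2κx ≤ 1` (induction);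
* §2 **`layerRatio_le_one_add`** — for `κ ≤ a`, `2(2a+1) ≤ n` and `x := 1/(2a+2−2κ) + 1/(n−2a−2κ) + 1/((2a+2−2κ)(n−2a−2κ))` with `2κx ≤ 1`:
  `R_κ ≤ 1 + 2κ·x` (each factor is `(1 + 1/(2a−2i))(1 + 1/(n−2a−2−2i)) ≤ 1 + x`);
* §3 **`layerRatio_le_one_add_div`** — in the cell's balanced regime `n ≤ 4(2a+1)`, `2(2a+1) ≤ n`, `24κ ≤ n`: `R_κ ≤ 1 + 24κ/n`, i.e.
  `ρ_{2κ} ≤ 24κ/n` (the planner's numerics `ρ₂ = 0.052`, `ρ₄ = 0.110`, `ρ₆ = 0.174` at `n = 80` are `≈ 4κ/n`; the constant 24 covers the whole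
  admissible range of `t`).
CONSEQUENCE (MEMO-37 §3, not formalised here): with brick 45's identity `Virt_D(X×Y) = μν + Σ_{1≤κ≤D/2} R_κ c_κ` and the tight expansion
`Tight(X×Y) = μν + Σ_{κ≥1} c_κ` (brick 27), `Virt_D − Tight = Σ_{κ≤D/2} ρ_{2κ} c_κ − Σ_{κ>D/2} c_κ`: the virtual value of a rectangle IS its
tight-level mass up to `(24/n)·Σ_κ κ|c_κ|` and the high modes — for a dense spread cell (VNS head estimate `|c_κ| ≤ 4μν16^{−κ}`) up to `7μν/n`,
which is what kit j333539 measures for block-count tilts and their second moments (relative virtual/tight discrepancy `≈ n^{−3/2}…n^{−1}`,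
`6·10⁻⁴` at `n = 400`). [cite: Grigoriev2001, Lemma 1.4 (PDF p. 8)] [cite: Rothvoss2017, §2 (PDF p. 6)] [cite: GodsilMeagher2015, §15.2]
Stature: support/instrument (kernel lane, no defs, axioms standard; an elementary inequality on brick 44b's closed form). WHAT THIS IS NOT: not the
two-sided «virtual = tight» theorem itself (needs bricks 19/27/45/46 re-plumbed, MEMO-37 §3), no proof or refutation of `TracialDecayExp20`, nothing on
psd rank of P_PM(K_n), no P-vs-NP content. Supports stmt-PneNP-19878.
-/

set_option linter.dupNamespace false -- `Summit.PneNP.PneNP.…`: summit = sub-problem (D-0017)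

noncomputable section

namespace Summit.PneNP.PneNP.Theorems.ChebyshevTracialDesignLayerRatioSharp

open Finset

variable {n : ℕ}

/-! ### §1 A Bernoulli-type upper bound -/

/-- `(1+x)^κ ≤ 1 + 2κx` whenever `0 ≤ x` and `2κx ≤ 1`. -/
theorem one_add_mul_pow_le {x : ℝ} (hx : 0 ≤ x) : ∀ {κ : ℕ}, 2 * (κ : ℝ) * x ≤ 1 → (1 + x) ^ κ ≤ 1 + 2 * (κ : ℝ) * x
  | 0, _ => by simp
  | k + 1, hk => by
    have hk' : 2 * (k : ℝ) * x ≤ 1 := by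
      have : (k : ℝ) ≤ (k + 1 : ℕ) := by exact_mod_cast Nat.le_succ k
      nlinarith
    have ih := one_add_mul_pow_le hx hk'
    have hkx : 2 * (k : ℝ) * x * x ≤ x := by nlinarith
    calc (1 + x) ^ (k + 1) = (1 + x) ^ k * (1 + x) := pow_succ _ _
      _ ≤ (1 + 2 * (k : ℝ) * x) * (1 + x) := mul_le_mul_of_nonneg_right ih (by linarith)
      _ = 1 + 2 * (k : ℝ) * x + x + 2 * (k : ℝ) * x * x := by ring
      _ ≤ 1 + 2 * ((k + 1 : ℕ) : ℝ) * x := by push_cast; nlinarith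

/-! ### §2 The sharp bound on the layer ratio -/

/-- **THE LAYER RATIO IS `1 + O(κ/n)`.** For `κ ≤ a`, `2(2a+1) ≤ n` and
`x = 1/(2a+2−2κ) + 1/(n−2a−2κ) + 1/((2a+2−2κ)(n−2a−2κ))` with `2κx ≤ 1`:
`R_κ = Π_{i<κ} (2a+1−2i)(n−2a−1−2i)/((2a−2i)(n−2a−2−2i)) ≤ 1 + 2κ·x`. Each factor equals `(1 + 1/(2a−2i))·(1 + 1/(n−2a−2−2i))` with
`2a−2i ≥ 2a+2−2κ` and `n−2a−2−2i ≥ n−2a−2κ` for `i < κ`, hence is `≤ 1 + x`; then `(1+x)^κ ≤ 1 + 2κx` (§1).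
[cite: Grigoriev2001, Lemma 1.4 (PDF p. 8)] [cite: GodsilMeagher2015, §15.2] -/
theorem layerRatio_le_one_add {a κ : ℕ} (ht : 2 * (2 * a + 1) ≤ n) (hκa : κ ≤ a)
    (hx : 2 * (κ : ℝ) * (1 / ((2 * a + 2 : ℝ) - 2 * κ) + 1 / ((n : ℝ) - 2 * a - 2 * κ) +
      1 / (((2 * a + 2 : ℝ) - 2 * κ) * ((n : ℝ) - 2 * a - 2 * κ))) ≤ 1) :
    ∏ i ∈ range κ, (((2 * a + 1 : ℝ) - 2 * i) * ((n : ℝ) - 2 * a - 1 - 2 * i) /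
        (((2 * a : ℝ) - 2 * i) * ((n : ℝ) - 2 * a - 2 - 2 * i))) ≤
      1 + 2 * (κ : ℝ) * (1 / ((2 * a + 2 : ℝ) - 2 * κ) + 1 / ((n : ℝ) - 2 * a - 2 * κ) +
        1 / (((2 * a + 2 : ℝ) - 2 * κ) * ((n : ℝ) - 2 * a - 2 * κ))) := by
  set X : ℝ := (2 * a + 2 : ℝ) - 2 * κ with hX
  set Yv : ℝ := (n : ℝ) - 2 * a - 2 * κ with hY
  have hX0 : (2 : ℝ) ≤ X := by
    have : (2 * κ + 2 : ℝ) ≤ 2 * a + 2 := by exact_mod_cast (show 2 * κ + 2 ≤ 2 * a + 2 by omega)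
    rw [hX]; linarith
  have hY0 : (2 : ℝ) ≤ Yv := by
    have : (2 * a + 2 * κ + 2 : ℝ) ≤ n := by exact_mod_cast (show 2 * a + 2 * κ + 2 ≤ n by omega)
    rw [hY]; linarith
  set x : ℝ := 1 / X + 1 / Yv + 1 / (X * Yv) with hxdef
  have hx0 : 0 ≤ x := by rw [hxdef]; positivity
  -- each factor is at most `1 + x`
  have hfac : ∀ i ∈ range κ, (((2 * a + 1 : ℝ) - 2 * i) * ((n : ℝ) - 2 * a - 1 - 2 * i) /
      (((2 * a : ℝ) - 2 * i) * ((n : ℝ) - 2 * a - 2 - 2 * i))) ≤ 1 + x := by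
    intro i hi
    have hi' := mem_range.1 hi
    set u : ℝ := (2 * a : ℝ) - 2 * i with hu
    set v : ℝ := (n : ℝ) - 2 * a - 2 - 2 * i with hv
    have huX : X ≤ u := by
      have : (2 * i + 2 : ℝ) ≤ 2 * κ := by exact_mod_cast (show 2 * i + 2 ≤ 2 * κ by omega)
      rw [hX, hu]; linarith
    have hvY : Yv ≤ v := by
      have : (2 * i + 2 : ℝ) ≤ 2 * κ := by exact_mod_cast (show 2 * i + 2 ≤ 2 * κ by omega)
      rw [hY, hv]; linarith
    have hu0 : 0 < u := by linarith
    have hv0 : 0 < v := by linarith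
    have hnum : ((2 * a + 1 : ℝ) - 2 * i) * ((n : ℝ) - 2 * a - 1 - 2 * i) = (u + 1) * (v + 1) := by
      rw [hu, hv]; ring
    rw [hnum, div_le_iff₀ (mul_pos hu0 hv0)]
    -- `(u+1)(v+1) = uv + u + v + 1 ≤ uv(1 + 1/X + 1/Y + 1/(XY))` since `v ≤ uv/X` etc.
    have h1 : v ≤ u * v * (1 / X) := by
      rw [mul_one_div, le_div_iff₀ (by linarith)]
      nlinarith
    have h2 : u ≤ u * v * (1 / Yv) := by
      rw [mul_one_div, le_div_iff₀ (by linarith)]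
      nlinarith
    have h3 : (1 : ℝ) ≤ u * v * (1 / (X * Yv)) := by
      rw [mul_one_div, le_div_iff₀ (by positivity)]
      have := mul_le_mul huX hvY (by linarith) hu0.le
      linarith
    calc (u + 1) * (v + 1) = u * v + v + u + 1 := by ring
      _ ≤ u * v + u * v * (1 / X) + u * v * (1 / Yv) + u * v * (1 / (X * Yv)) := by linarith
      _ = (1 + x) * (u * v) := by rw [hxdef]; ring
  have hnonneg : ∀ i ∈ range κ, 0 ≤ (((2 * a + 1 : ℝ) - 2 * i) * ((n : ℝ) - 2 * a - 1 - 2 * i) /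
      (((2 * a : ℝ) - 2 * i) * ((n : ℝ) - 2 * a - 2 - 2 * i))) := by
    intro i hi
    have hi' := mem_range.1 hi
    have hu : (0 : ℝ) < (2 * a : ℝ) - 2 * i := by
      have : (2 * i : ℝ) < 2 * a := by exact_mod_cast (show 2 * i < 2 * a by omega)
      linarith
    have hv : (0 : ℝ) < (n : ℝ) - 2 * a - 2 - 2 * i := by
      have : (2 * a + 2 + 2 * i : ℝ) < n := by exact_mod_cast (show 2 * a + 2 + 2 * i < n by omega)
      linarith
    exact div_nonneg (mul_nonneg (by linarith) (by linarith)) (mul_pos hu hv).le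
  calc _ ≤ ∏ _i ∈ range κ, (1 + x) := prod_le_prod hnonneg hfac
    _ = (1 + x) ^ κ := by simp
    _ ≤ 1 + 2 * (κ : ℝ) * x := one_add_mul_pow_le hx0 (by rw [hxdef]; exact hx)

/-! ### §3 The balanced regime: `ρ_{2κ} ≤ 24κ/n` -/

/-- **In the cell's balanced regime the layer ratio is at most `1 + 24κ/n`.** If `n ≤ 4(2a+1)`, `2(2a+1) ≤ n` and `24κ ≤ n`, then
`R_κ ≤ 1 + 24κ/n` — so the virtual level re-weights the tight mode of layer `2κ` by `1 + ρ_{2κ}` with `0 ≤ ρ_{2κ} ≤ 24κ/n` (brick 44b had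
`ρ_{2κ} ≤ 2^κ − 1`). (Here `2a+2−2κ ≥ n/8` and `n−2a−2κ ≥ 3n/8`, so the `x` of §2 is `≤ 12/n`.)
[cite: Grigoriev2001, Lemma 1.4 (PDF p. 8)] [cite: Rothvoss2017, §2 (PDF p. 6)] [cite: GodsilMeagher2015, §15.2] -/
theorem layerRatio_le_one_add_div {a κ : ℕ} (ht : 2 * (2 * a + 1) ≤ n) (hbal : n ≤ 4 * (2 * a + 1)) (hκ : 24 * κ ≤ n) :
    ∏ i ∈ range κ, (((2 * a + 1 : ℝ) - 2 * i) * ((n : ℝ) - 2 * a - 1 - 2 * i) /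
        (((2 * a : ℝ) - 2 * i) * ((n : ℝ) - 2 * a - 2 - 2 * i))) ≤ 1 + 24 * (κ : ℝ) / n := by
  rcases Nat.eq_zero_or_pos κ with hκ0 | hκpos
  · subst hκ0; simp
  have hn0 : 0 < n := by omega
  have hnR : (0 : ℝ) < n := by exact_mod_cast hn0
  have hn24 : (24 : ℝ) ≤ n := by exact_mod_cast (le_trans (by omega : 24 ≤ 24 * κ) hκ)
  have hκa : κ ≤ a := by omega
  -- the two denominators
  have hX : (n : ℝ) / 8 ≤ (2 * a + 2 : ℝ) - 2 * κ := by
    have : (n : ℝ) ≤ 8 * ((2 * a + 2 : ℝ) - 2 * κ) := by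
      have h1 : (n : ℝ) ≤ 4 * (2 * a + 1) := by exact_mod_cast hbal
      have h2 : (24 * κ : ℝ) ≤ n := by exact_mod_cast hκ
      linarith
    linarith
  have hY : 3 * (n : ℝ) / 8 ≤ (n : ℝ) - 2 * a - 2 * κ := by
    have h1 : (2 * (2 * a + 1) : ℝ) ≤ n := by exact_mod_cast ht
    have h2 : (24 * κ : ℝ) ≤ n := by exact_mod_cast hκ
    linarith
  have hX0 : (0 : ℝ) < (2 * a + 2 : ℝ) - 2 * κ := by linarith [show (0:ℝ) < n / 8 by positivity]
  have hY0 : (0 : ℝ) < (n : ℝ) - 2 * a - 2 * κ := by linarith [show (0:ℝ) < 3 * n / 8 by positivity]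
  set x : ℝ := 1 / ((2 * a + 2 : ℝ) - 2 * κ) + 1 / ((n : ℝ) - 2 * a - 2 * κ) +
      1 / (((2 * a + 2 : ℝ) - 2 * κ) * ((n : ℝ) - 2 * a - 2 * κ)) with hxdef
  -- `x ≤ 12/n`
  have h1 : 1 / ((2 * a + 2 : ℝ) - 2 * κ) ≤ 8 / n := by
    rw [div_le_div_iff₀ hX0 hnR]; linarith
  have h2 : 1 / ((n : ℝ) - 2 * a - 2 * κ) ≤ 8 / (3 * n) := by
    rw [div_le_div_iff₀ hY0 (by positivity)]; linarith
  have h3 : 1 / (((2 * a + 2 : ℝ) - 2 * κ) * ((n : ℝ) - 2 * a - 2 * κ)) ≤ 64 / (3 * (n : ℝ) ^ 2) := by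
    rw [div_le_div_iff₀ (mul_pos hX0 hY0) (by positivity)]
    have := mul_le_mul hX hY (by positivity) hX0.le
    nlinarith
  have hx12 : x ≤ 12 / n := by
    have h4 : 64 / (3 * (n : ℝ) ^ 2) ≤ 1 / n := by
      rw [div_le_div_iff₀ (by positivity) hnR]; nlinarith [hn24, hnR]
    have h5 : (8 : ℝ) / n + 8 / (3 * n) + 1 / n ≤ 12 / n := by
      rw [div_add_div _ _ hnR.ne' (by positivity), div_add_div _ _ (by positivity) hnR.ne', div_le_div_iff₀ (by positivity) hnR]
      nlinarith
    calc x ≤ 8 / n + 8 / (3 * n) + 1 / n := by rw [hxdef]; linarith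
      _ ≤ 12 / n := h5
  have hκx : 2 * (κ : ℝ) * x ≤ 1 := by
    have hκR : (24 * κ : ℝ) ≤ n := by exact_mod_cast hκ
    have hκ0 : (0 : ℝ) ≤ κ := Nat.cast_nonneg _
    calc 2 * (κ : ℝ) * x ≤ 2 * κ * (12 / n) := mul_le_mul_of_nonneg_left hx12 (by positivity)
      _ = 24 * κ / n := by ring
      _ ≤ 1 := by rw [div_le_one hnR]; exact hκR
  have hmain := layerRatio_le_one_add (n := n) ht hκa (by rw [← hxdef]; exact hκx)
  rw [← hxdef] at hmain
  refine hmain.trans ?_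
  have hκ0 : (0 : ℝ) ≤ κ := Nat.cast_nonneg _
  calc 1 + 2 * (κ : ℝ) * x ≤ 1 + 2 * κ * (12 / n) := by nlinarith [mul_le_mul_of_nonneg_left hx12 (by positivity : (0:ℝ) ≤ 2 * κ)]
    _ = 1 + 24 * (κ : ℝ) / n := by ring

end Summit.PneNP.PneNP.Theorems.ChebyshevTracialDesignLayerRatioSharp
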